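import Mathlib.Algebra.MonoidAlgebra.Module
import Mathlib.LinearAlgebra.Basis.Basic
import HarnessLib

/-!
# Group-like elements of a group algebra: `1`, `[g]`, `[g⁻¹]` are linearly independent when `g² ≠ 1`

Elementary, sorry-free, THEOREMS ONLY (no definition, no named fact); namespace
`Literature.Algebra.GroupRings`. In the group algebra `k[G]` (Mathlib `MonoidAlgebra k G`, group-like
elements `[g] = MonoidAlgebra.single g 1`, standard basis `MonoidAlgebra.basis`):

* `linearIndependent_single_one_restrict` — the group-likes `[g]`, `g ∈ S`, are linearly independent
  for ANY subset `S ⊆ G` (restriction of the standard basis);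
* `coeff_combination_one_single` — the coefficient of `[m]` in `a·1 + c·[h]`;
* `eq_zero_of_one_add_single_inv_eq_one_add_single` — if `g² ≠ 1` then an identity
  `a·1 + c·[g⁻¹] = a'·1 + c'·[g]` forces `c' = 0` and `c = 0` (and then `a = a'`);
* `one_add_single_inv_ne_one_add_single` — hence `a·1 + c·[g⁻¹] ≠ a'·1 + c'·[g]` whenever `c' ≠ 0`.

## Why this file exists (documentary; nothing below depends on it)

Cell `bsd-litref/cgs25`, the L-η assembly of [KLZ17]: referee C4 ROUND C4-R5-ADD-4 (v2) re-derived, for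
reader 2's ERRATUM E-r2-1 (D-AUDIT-cgs25-r2-ADDENDUM-11 §1), that the Fricke conjugate of an Eisenstein
`T_ℓ`-value `𝔄 = η₁(ℓ) + η₂(ℓ)ℓ[ℓ] ∈ Λ_D ⊗ 𝒪` is `ι(𝔄) = η₁(ℓ) + η₂(ℓ)ℓ[ℓ]⁻¹` (diamond inversion
`w⟨d⟩w⁻¹ = ⟨d⟩⁻¹`, Diamond–Shurman (5.16)/Exercise 5.5.1(a) [corpus:
book:diamond2005-first-course-modular-forms p0208:L7–L20]; KLZ Prop 7.2.1(1) «acting via the inverse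
diamond operators at p» [corpus: paper:arxiv-1503.02888-gx17373040 p0059:L15–L17]) and that `ι(𝔄)` is NO
`T_ℓ`-value `η₁′(ℓ) + η₂′(ℓ)ℓ[ℓ]` of an ordinary Eisenstein system «because `1, [ℓ], [ℓ]⁻¹` are
`𝒪`-linearly independent group-likes (`ℓ` has infinite order in `ℤ_pˣ`)». This file is that linear
independence BY NAME, in the (uncompleted) group algebra `k[G]` of any group — apply it with `G = ℤ_pˣ`
(`ℓ² ≠ 1`) or at finite level `G = (ℤ/Np^r)ˣ` (`ℓ² ≢ 1`). HONEST SCOPE: pure algebra; the completed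
group ring `𝒪⟦ℤ_pˣ⟧` and the Eisenstein eigenvalues themselves are not formalised here. Companion:
`Literature/LinearAlgebra/ConjugationTransport.lean` (the conjugation twist `conj_aeval`,
`eigenspace_conj_eq_map`).

## References

* [DiamondShurman2005] F. Diamond, J. Shurman, GTM 228, Thm. 5.5.3, (5.16), Exercise 5.5.1(a), Prop. 5.2.3.
* [KingsLoefflerZerbes2015] G. Kings, D. Loeffler, S. L. Zerbes, arXiv:1503.02888, Prop. 7.2.1(1).
-/

namespace Literature.Algebra.GroupRings

open MonoidAlgebra

section Semiring

variable {k G : Type*} [Semiring k] [Group G]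

omit [Group G] in
/-- **Group-likes are linearly independent**: for any subset `S ⊆ G`, the family `g ↦ [g] = single g 1`,
`g ∈ S`, is linearly independent in `k[G]` (restriction of the standard basis `MonoidAlgebra.basis`).
[cite: DiamondShurman2005, (5.16) and Exercise 5.5.1(a) (corpus book:diamond2005-first-course-modular-forms p0208:L7–L20: w⟨d⟩w⁻¹ = ⟨d⟩⁻¹ — the group-likes whose independence the witness uses; referee C4 C4-R5-ADD-4 (v2), in-cell)] -/
theorem linearIndependent_single_one_restrict (S : Set G) :
    LinearIndependent k (fun g : S ↦ (MonoidAlgebra.single (g : G) (1 : k) : MonoidAlgebra k G)) := by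
  have h := (MonoidAlgebra.basis G k).linearIndependent.comp (Subtype.val : S → G)
    Subtype.val_injective
  convert h using 1
  funext g
  simp only [Function.comp_apply, MonoidAlgebra.basis_apply]

/-- **The coefficient of `[m]` in `a·1 + c·[h]`** is `(if 1 = m then a else 0) + (if h = m then c else 0)`.
[cite: DiamondShurman2005, (5.16) (group-like bookkeeping for the witness; C4-R5-ADD-4 (v2), in-cell)] -/
theorem coeff_combination_one_single [DecidableEq G] (a c : k) (h m : G) :
    (a • (1 : MonoidAlgebra k G) + c • MonoidAlgebra.single h (1 : k)).coeff m =
      (if (1 : G) = m then a else 0) + (if h = m then c else 0) := by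
  rw [coeff_add, coeff_smul, coeff_smul, one_def, coeff_single, coeff_single, Finsupp.add_apply,
    Finsupp.smul_apply, Finsupp.smul_apply, Finsupp.single_apply, Finsupp.single_apply]
  simp only [smul_eq_mul, mul_ite, mul_one, mul_zero]

end Semiring

section Ring

variable {k G : Type*} [Semiring k] [Group G]

/-- **If `g² ≠ 1`, an identity `a·1 + c·[g⁻¹] = a'·1 + c'·[g]` in `k[G]` forces `c' = 0` and `c = 0`**
(compare the coefficients of `[g]` and of `[g⁻¹]`; `g ≠ 1`, `g⁻¹ ≠ 1`, `g⁻¹ ≠ g`). With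
`a = η₁(ℓ)`, `c = η₂(ℓ)ℓ`, `g = [ℓ]`: the Fricke conjugate `ι(𝔄) = η₁(ℓ) + η₂(ℓ)ℓ[ℓ]⁻¹` of an Eisenstein
`T_ℓ`-value is no Eisenstein `T_ℓ`-value `η₁′(ℓ) + η₂′(ℓ)ℓ[ℓ]` (as `η₂′(ℓ)ℓ ≠ 0`), so `wΘ₀w⁻¹ ≠ Θ₀`
(cgs25-r2 ADDENDUM-11 §1; referee C4 C4-R5-ADD-4 (v2)). [cite: KingsLoefflerZerbes2015, Prop. 7.2.1(1) (corpus paper:arxiv-1503.02888-gx17373040 p0059:L15–L17: «acting via the inverse diamond operators at p»; the independence step of C4-R5-ADD-4 (v2), in-cell)] [cite: DiamondShurman2005, (5.16)] -/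
theorem eq_zero_of_one_add_single_inv_eq_one_add_single {g : G} (hg : g * g ≠ 1) {a c a' c' : k}
    (h : a • (1 : MonoidAlgebra k G) + c • MonoidAlgebra.single g⁻¹ (1 : k) =
      a' • 1 + c' • MonoidAlgebra.single g (1 : k)) : c' = 0 ∧ c = 0 := by
  have hg1 : (1 : G) ≠ g := fun h1 ↦ hg (by rw [← h1, one_mul])
  have hg2 : g⁻¹ ≠ g := fun h2 ↦ hg (by rw [← mul_inv_cancel g, h2])
  have hg3 : (1 : G) ≠ g⁻¹ := fun h3 ↦ hg1 (by rw [← inv_inv g, ← h3, inv_one])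
  classical
  constructor
  · have hc := congrArg (fun x : MonoidAlgebra k G ↦ x.coeff g) h
    rw [coeff_combination_one_single, coeff_combination_one_single, if_neg hg1, if_neg hg2, if_neg hg1,
      if_pos rfl, zero_add, zero_add] at hc
    exact hc.symm
  · have hc := congrArg (fun x : MonoidAlgebra k G ↦ x.coeff g⁻¹) h
    rw [coeff_combination_one_single, coeff_combination_one_single, if_neg hg3, if_pos rfl, if_neg hg3,
      if_neg hg2.symm, zero_add, zero_add] at hc
    exact hc

/-- **Hence `a·1 + c·[g⁻¹] ≠ a'·1 + c'·[g]` whenever `g² ≠ 1` and `c' ≠ 0`.**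
[cite: KingsLoefflerZerbes2015, Prop. 7.2.1(1) (independence step of C4-R5-ADD-4 (v2) / cgs25-r2 ADDENDUM-11 §1, in-cell)] -/
theorem one_add_single_inv_ne_one_add_single {g : G} (hg : g * g ≠ 1) {a c a' c' : k} (hc' : c' ≠ 0) :
    a • (1 : MonoidAlgebra k G) + c • MonoidAlgebra.single g⁻¹ (1 : k) ≠
      a' • 1 + c' • MonoidAlgebra.single g (1 : k) :=
  fun h ↦ hc' (eq_zero_of_one_add_single_inv_eq_one_add_single hg h).1

end Ring

end Literature.Algebra.GroupRings
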